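/-
Copyright: statement-level skeleton of a published paper (lit-balaban cell, Phase-2 proof seat p10, gen 4). No proof claims
beyond what the kernel checks below.
-/
import Mathlib
import Literature.MathematicalPhysics.QuantumFieldTheory.BalabanImbrieJaffe1984to88.BIJ85Eq7113DerivationPart2

/-!
# `BalabanImbrieJaffe1984to88.BIJ85Eq7113DerivationPart3` — T. Bałaban, J. Imbrie, A. Jaffe, *Renormalization of the Higgs model:
minimizers, propagators and the stability of mean field theory*, Commun. Math. Phys. **97** (1985) 299–329
[BalabanImbrieJaffe1985]: Sect. 7.1 p. 322 — **the derivation (7.1.12) ⟹ (7.1.13)–(7.1.16) at a fixed fibre p′; file 3/3: (7.1.13) as the minimal energy, and Theorem 7.1.1 for the energies**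

statement-level skeleton of published theorems with citation tags; proofs where landed; nothing here is a claim about
the Yang–Mills mass gap

CITATION HEADER (lean-in-tree rule).  Part of the lit-balaban TYPED SKELETON (HOME `run/shared/lean/pub/lit-balaban/`); WHAT IS
REPRODUCED: the derivation member of SKELETON rows **C1.Eq7.1.13-7.1.19** / **C1.Thm7.1.1** of `HOME/lit-balaban-r15/ROWS-C1.md`
(fold owner r15, referee ref-5) — p. 322 [PDF 24]: *"Starting from this expression, one can derive the following formulas for σ_k(p)
by straightforward, algebraic manipulation: We express σ_k as a sum of two terms σ_k = τ₁ + τ₂. (7.1.13)"*.  The setting, the printed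
inputs ((4.2.1), (2.13)–(2.24), [6I] (1.61), (7.1.4)–(7.1.16)), the weight convention note and all DEFINITIONS are in
`BIJ85Eq7113Derivation` (file 1/3 of this derivation); this file has theorems only.

WHAT IS PROVED by the three files (zero `sorry`, standard axioms): the pointwise Hodge split Q^{e*}f = ∂B₀ + R (`qeStar_eq`) with R ⟂ curls
(`sum_curl_remF`); Q_kB₀ = (Σ_μā_μf_{μν})_ν — **this is where a_μ (7.1.16) appears: a_μ = (Q^e_k∂Δ⁻¹Q_k^*)_μ** (`qOp_bZero`);
Q_kA₁ = φc — **φ_μ (7.1.10) is the Gram matrix Q_kΔ⁻¹Q_k^*** (`qOp_aOne`); the constraint Q_kA* = 0 (`qOp_minimiser`, the gauge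
parameter absorbing the component along ∂^{(1)}); d^*A₁ = 0 (`divF_aOne`, from c ⟂ ∂^{(1)}, i.e. z ⟂ x: the bracket of (7.1.15) is
the projection onto (∂^{(1)}_ν/√φ_ν)^⊥); the normal equations ⟨∂A, Q^{e*}f − ∂A*⟩ = 0 for all constrained A (`normal_eq`, via
⟨∂A,∂B⟩ = Δ⟨A,B⟩ − \overline{d^*A}·d^*B, `sum_curl_curl`); the value ‖Q^{e*}f − ∂A*‖² = ‖R‖² + ‖∂A₁‖² with
**‖R‖² = ⟨f,τ₁f⟩** (`pNormSq_remF`; (7.1.17) τ₁ = Q^e_k(I − P_∂)Q^{e*}_k) and **‖∂A₁‖² = ‖P_xy‖² = ⟨f,τ₂f⟩** (`pNormSq_curl_aOne`,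
gen-2 `tensorInner_tau2Kernel_eq_normSq`); hence **`isLeast_energy`/`sigmaMin_eq`: for every antisymmetric f,
min{‖∂A − Q^{e*}_kf‖² : Q_kA = 0} = Σ_{μνλκ}\bar{f}_{μν}(τ₁ + τ₂)_{μνλκ}(p′)f_{λκ} = Re⟨f, `sigmaSym` f⟩ (imaginary part 0)** —
(7.1.13) with (7.1.14)–(7.1.16) as printed; and with gen-4 `thm711_closedCube'`: **c(d)‖f‖² ≤ ‖∂A − Q^{e*}_kf‖² for every A with
Q_kA = 0** at every scale (η = 1/n, 2M + 1 ≤ n) and every p′ with all 0 < |p′_μ| ≤ π (`thm711_energy`).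
(The weight algebra is file 1/3 `BIJ85Eq7113Derivation`, the Hodge split and the normal equations file 2/3 `BIJ85Eq7113DerivationPart2`.)
Unit `lit-balaban-p10` (gen 4), HOME as above.
-/

namespace Literature.MathematicalPhysics.QuantumFieldTheory.BalabanImbrieJaffe1984to88.BIJ85Eq7113DerivationPart3


open scoped BigOperators Real ComplexConjugate Matrix Kronecker
open Complex Finset Matrix
open Literature.MathematicalPhysics.QuantumFieldTheory.BalabanImbrieJaffe1984to88.BIJ85MomentumSymbols71
open Literature.MathematicalPhysics.QuantumFieldTheory.BalabanImbrieJaffe1984to88.BIJ85CurlComplement719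
open Literature.MathematicalPhysics.QuantumFieldTheory.BalabanImbrieJaffe1984to88.BIJ85Tau0Positivity729
open Literature.MathematicalPhysics.QuantumFieldTheory.BalabanImbrieJaffe1984to88.BIJ85Tau2Kernel715
open Literature.MathematicalPhysics.QuantumFieldTheory.BalabanImbrieJaffe1984to88.BIJ85SigmaOnCurls325
open Literature.MathematicalPhysics.QuantumFieldTheory.BalabanImbrieJaffe1984to88.BIJ85Prop712Fibre
open Literature.MathematicalPhysics.QuantumFieldTheory.BalabanImbrieJaffe1984to88.BIJ85Thm711Fibrewise
open Literature.MathematicalPhysics.QuantumFieldTheory.BalabanImbrieJaffe1984to88.BIJ85SigmaClosedCube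
open Literature.MathematicalPhysics.QuantumFieldTheory.BalabanImbrieJaffe1984to88.BIJ85Thm711ClosedCube

open Literature.MathematicalPhysics.QuantumFieldTheory.BalabanImbrieJaffe1984to88.BIJ85Eq7113Derivation
open Literature.MathematicalPhysics.QuantumFieldTheory.BalabanImbrieJaffe1984to88.BIJ85Eq7113DerivationPart2

noncomputable section

variable {d : ℕ}

section Proofs

variable {η : ℝ} {M : ℕ} {p : Fin d → ℝ}

/-- kernel: z z̄ = |z|² in ℂ. [folklore] -/
private theorem mul_conj_eq (z : ℂ) : z * conj z = ((‖z‖ ^ 2 : ℝ) : ℂ) := by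
  rw [Complex.mul_conj, Complex.normSq_eq_norm_sq]

/-- kernel: z̄ z = |z|² in ℂ. [folklore] -/
private theorem conj_mul_eq (z : ℂ) : conj z * z = ((‖z‖ ^ 2 : ℝ) : ℂ) := by
  rw [mul_comm, mul_conj_eq]

/-- kernel: |x + y|² = |x|² + |y|² + 2Re(x̄y) in ℂ. [folklore] -/
private theorem norm_add_sq_complex (x y : ℂ) : ‖x + y‖ ^ 2 = ‖x‖ ^ 2 + ‖y‖ ^ 2 + 2 * (conj x * y).re := by
  apply Complex.ofReal_injective
  rw [Complex.ofReal_add, Complex.ofReal_add, ← mul_conj_eq, ← mul_conj_eq, ← mul_conj_eq, ← Complex.add_conj]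
  simp only [map_add, map_mul, Complex.conj_conj]
  ring

/-- kernel: for a self-adjoint idempotent matrix A, x̄·(Ax) = |Ax|². [folklore] -/
private theorem star_dot_mulVec_of_proj {ι : Type*} [Fintype ι] [DecidableEq ι] (A : Matrix ι ι ℂ) (hA : Aᴴ = A)
    (hA2 : A * A = A) (x : ι → ℂ) :
    star x ⬝ᵥ (A *ᵥ x) = ((∑ i, ‖(A *ᵥ x) i‖ ^ 2 : ℝ) : ℂ) := by
  have h : star x ⬝ᵥ (A *ᵥ x) = star (A *ᵥ x) ⬝ᵥ (A *ᵥ x) := by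
    rw [Matrix.star_mulVec, hA, ← Matrix.dotProduct_mulVec, Matrix.mulVec_mulVec, hA2]
  rw [h]
  simp only [dotProduct, Pi.star_apply, Complex.star_def, Complex.conj_mul']
  push_cast
  rfl

/-- kernel: P ⊗ P is a self-adjoint idempotent. [folklore] -/
private theorem kronecker_proj (e : Fin d → ℂ) :
    (projK e ⊗ₖ projK e)ᴴ = projK e ⊗ₖ projK e ∧ (projK e ⊗ₖ projK e) * (projK e ⊗ₖ projK e) = projK e ⊗ₖ projK e := by
  constructor
  · rw [Matrix.conjTranspose_kronecker, projK_conjTranspose]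
  · rw [← Matrix.mul_kronecker_mul, projK_mul_projK]

/-- kernel, Lagrange's identity for a divergence-free y: Σ_{μν}|e_μy_ν − e_νy_μ|² = 2Σ|e_μ|²Σ|y_ν|². [folklore] -/
private theorem lagrange_real (e y : Fin d → ℂ) (hdiv : ∑ κ, conj (e κ) * y κ = 0) :
    ∑ μ, ∑ ν, ‖e μ * y ν - e ν * y μ‖ ^ 2 = 2 * (∑ μ, ‖e μ‖ ^ 2) * ∑ ν, ‖y ν‖ ^ 2 := by
  have h := lagrange_identity e y
  rw [hdiv, mul_zero, sub_zero] at h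
  apply Complex.ofReal_injective
  rw [Complex.ofReal_mul, Complex.ofReal_mul, Complex.ofReal_ofNat, Complex.ofReal_sum, Complex.ofReal_sum,
    Complex.ofReal_sum]
  simp_rw [Complex.ofReal_sum]
  rw [show (∑ μ, ∑ ν, (((‖e μ * y ν - e ν * y μ‖ ^ 2 : ℝ)) : ℂ)) =
      ∑ μ, ∑ ν, (e μ * y ν - e ν * y μ) * conj (e μ * y ν - e ν * y μ) from
      Finset.sum_congr rfl fun _ _ => Finset.sum_congr rfl fun _ _ => (mul_conj_eq _).symm,
    show (∑ μ, (((‖e μ‖ ^ 2 : ℝ)) : ℂ)) = ∑ μ, conj (e μ) * e μ from Finset.sum_congr rfl fun _ _ => (conj_mul_eq _).symm,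
    show (∑ ν, (((‖y ν‖ ^ 2 : ℝ)) : ℂ)) = ∑ ν, conj (y ν) * y ν from Finset.sum_congr rfl fun _ _ => (conj_mul_eq _).symm, h]
  ring

/-- kernel: Σ_{μν}|((P ⊗ P)g)_{μν}|² = ḡ·((P ⊗ P)g) for the bracket P. [folklore] -/
private theorem kron_norm_identity (e : Fin d → ℂ) (g : Fin d → Fin d → ℂ) :
    ∑ μ, ∑ ν, (((‖∑ l, ∑ κ, projK e μ l * projK e ν κ * g l κ‖ ^ 2 : ℝ)) : ℂ) =
      ∑ μ, ∑ ν, conj (g μ ν) * ∑ l, ∑ κ, projK e μ l * projK e ν κ * g l κ := by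
  have hv : ∀ μ ν, (∑ l, ∑ κ, projK e μ l * projK e ν κ * g l κ) =
      ((projK e ⊗ₖ projK e) *ᵥ fun i : Fin d × Fin d => g i.1 i.2) (μ, ν) := by
    intro μ ν
    rw [Matrix.mulVec, dotProduct, Fintype.sum_prod_type]
    simp only [Matrix.kroneckerMap_apply]
  have h2 : (∑ μ, ∑ ν, conj (g μ ν) * ∑ l, ∑ κ, projK e μ l * projK e ν κ * g l κ) =
      star (fun i : Fin d × Fin d => g i.1 i.2) ⬝ᵥ ((projK e ⊗ₖ projK e) *ᵥ fun i : Fin d × Fin d => g i.1 i.2) := by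
    rw [dotProduct, Fintype.sum_prod_type]
    refine Finset.sum_congr rfl fun μ _ => Finset.sum_congr rfl fun ν _ => ?_
    rw [Pi.star_apply, Complex.star_def, Matrix.mulVec, dotProduct, Fintype.sum_prod_type]
    simp only [Matrix.kroneckerMap_apply]
  rw [h2, star_dot_mulVec_of_proj _ (kronecker_proj _).1 (kronecker_proj _).2, Fintype.sum_prod_type]
  simp_rw [hv]
  push_cast
  rfl

/-- Σ_{μν}|R_{μν}(l)|² = Σ_{μνλκ}\bar{f}_{μν}(|u|²/(v̄_μv̄_νv_λv_κ)[δ − ∂∂̄/Δ]_{μλ}[δ − ∂∂̄/Δ]_{νκ})(p′+l)f_{λκ} — r15's `tau1Term` (7.1.14)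
at the shift l, verbatim (any η, any momentum). [cite: BalabanImbrieJaffe1985, (7.1.14) p.322] -/
theorem sum_normSq_remF (f : Fin d → Fin d → ℂ) (m : Fin d → ℤ) :
    ∑ μ, ∑ ν, (((‖remF η p f m μ ν‖ ^ 2 : ℝ)) : ℂ) = tensorInner f (tau1Term η (shiftMom p m)) f := by
  unfold remF
  rw [kron_norm_identity]
  unfold tensorInner
  refine Finset.sum_congr rfl fun μ _ => Finset.sum_congr rfl fun ν _ => ?_
  rw [Finset.mul_sum]
  refine Finset.sum_congr rfl fun l _ => ?_
  rw [Finset.mul_sum]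
  refine Finset.sum_congr rfl fun κ _ => ?_
  rw [tau1Term, projSym_eq_projK, projSym_eq_projK]
  unfold qeStar wE
  simp only [map_mul, map_div₀, Complex.conj_conj]
  rw [← mul_conj_eq]
  ring

/-- **‖R‖² = ⟨f, τ₁(p′)f⟩** with r15's `tau1Sym` (7.1.14) verbatim (the ½ of (7.1.14) = the ½ of the plaquette pairing (2.20)):
(7.1.17) *"τ₁ = Q^e_k(I − P_∂)Q^{e*}_k"*. [cite: BalabanImbrieJaffe1985, (7.1.14) p.322] -/
theorem pNormSq_remF (f : Fin d → Fin d → ℂ) :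
    (pNormSq M (remF η p f) : ℂ) = tensorInner f (tau1Sym η M p) f := by
  rw [tensorInner_tau1Sym, pNormSq, Complex.ofReal_mul, Complex.ofReal_sum]
  rw [show (((1 / 2 : ℝ)) : ℂ) = 1 / 2 by norm_num]
  congr 1
  refine Finset.sum_congr rfl fun m _ => ?_
  rw [← sum_normSq_remF f m, Complex.ofReal_sum]
  exact Finset.sum_congr rfl fun μ _ => Complex.ofReal_sum _ _

/-- **‖∂A₁‖² = ‖P_xy‖² = ⟨f, τ₂(p′)f⟩** with r15's `tau2Sym` (7.1.15)–(7.1.16) verbatim (gen-2 `tensorInner_tau2Kernel_eq_normSq`).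
[cite: BalabanImbrieJaffe1985, (7.1.15) p.323] -/
theorem pNormSq_curl_aOne (hG : Generic η M p) (f : Fin d → Fin d → ℂ) :
    (pNormSq M (curlF η p (aOne η M p f)) : ℂ) = tensorInner f (tau2Sym η M p) f := by
  rw [tau2Sym_eq_kernel, tensorInner_tau2Kernel_eq_normSq hG.phi_pos hG.enn_ne]
  congr 1
  have hm_term : ∀ m ∈ lShifts d M, ∑ μ, ∑ ν, ‖curlF η p (aOne η M p f) m μ ν‖ ^ 2 =
      2 * ∑ ν, ‖uSym η (shiftMom p m) * vSym η (shiftMom p m) ν‖ ^ 2 * (lapSym η (shiftMom p m))⁻¹ *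
        ‖cVec η M p f ν‖ ^ 2 := by
    intro m hm
    have hL : lapSym η (shiftMom p m) ≠ 0 := hG.lap_ne m hm
    have hL0 : 0 ≤ lapSym η (shiftMom p m) := Finset.sum_nonneg fun _ _ => sq_nonneg _
    have h1 := lagrange_real (dSym η (shiftMom p m)) (aOne η M p f m) (divF_aOne hG f hm)
    unfold curlF
    rw [h1, show ((∑ μ, ‖dSym η (shiftMom p m) μ‖ ^ 2 : ℝ)) = lapSym η (shiftMom p m) from rfl, mul_assoc,
      Finset.mul_sum, Finset.mul_sum, Finset.mul_sum]
    refine Finset.sum_congr rfl fun ν _ => ?_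
    rw [aOne, norm_mul, norm_mul, Complex.norm_conj, Complex.norm_real, Real.norm_eq_abs, abs_of_nonneg (inv_nonneg.mpr hL0)]
    rw [show ‖rQ η p m ν‖ = ‖uSym η (shiftMom p m) * vSym η (shiftMom p m) ν‖ from rfl]
    field_simp
  unfold pNormSq
  rw [Finset.sum_congr rfl hm_term, ← Finset.mul_sum, ← mul_assoc, show (1 / 2 : ℝ) * 2 = 1 by norm_num, one_mul,
    Finset.sum_comm]
  refine Finset.sum_congr rfl fun ν _ => ?_
  rw [← Finset.sum_mul, show (∑ m ∈ lShifts d M, ‖uSym η (shiftMom p m) * vSym η (shiftMom p m) ν‖ ^ 2 *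
      (lapSym η (shiftMom p m))⁻¹) = phiSym η M p ν from rfl]
  unfold cVec zVec xVec yVec
  rw [norm_mul, mul_pow, norm_sqrtInv_sq hG.phi_pos]
  field_simp [(hG.phi_pos ν).ne']

/-- The value at the minimiser: ‖∂A* − Q^{e*}_kf‖² = Σ\bar{f}(τ₁ + τ₂)f (gen-3 `sigmaSym` = r15 `tau1Sym` + `tau2Sym`).
[cite: BalabanImbrieJaffe1985, (7.1.13) p.322] -/
theorem energy_minimiser (hG : Generic η M p) {f : Fin d → Fin d → ℂ} (hf : IsTwoForm f) :
    (energy η M p (minimiser η M p f) f : ℂ) = tensorInner f (sigmaSym η M p) f := by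
  have hpt : ∀ m ∈ lShifts d M, ∀ μ ν, curlF η p (minimiser η M p f) m μ ν - qeStar η p f m μ ν =
      -(remF η p f m μ ν + curlF η p (aOne η M p f) m μ ν) := by
    intro m hm μ ν
    rw [qeStar_eq (η := η) (p := p) hf m μ ν]
    unfold curlF minimiser
    ring
  have hcross : ∀ m ∈ lShifts d M, ∑ μ, ∑ ν, ‖remF η p f m μ ν + curlF η p (aOne η M p f) m μ ν‖ ^ 2 =
      ∑ μ, ∑ ν, ‖remF η p f m μ ν‖ ^ 2 + ∑ μ, ∑ ν, ‖curlF η p (aOne η M p f) m μ ν‖ ^ 2 := by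
    intro m hm
    have h0 : ∑ μ, ∑ ν, conj (curlF η p (aOne η M p f) m μ ν) * remF η p f m μ ν = 0 := sum_curl_remF hG f _ hm
    have h0' : ∑ μ, ∑ ν, conj (remF η p f m μ ν) * curlF η p (aOne η M p f) m μ ν = 0 := by
      have h := congrArg conj h0
      rw [map_sum, map_zero] at h
      rw [← h]
      refine Finset.sum_congr rfl fun μ _ => ?_
      rw [map_sum]
      refine Finset.sum_congr rfl fun ν _ => ?_
      rw [map_mul, Complex.conj_conj, mul_comm]
    have hre : (∑ μ, ∑ ν, 2 * (conj (remF η p f m μ ν) * curlF η p (aOne η M p f) m μ ν).re) = 0 := by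
      rw [show (∑ μ, ∑ ν, 2 * (conj (remF η p f m μ ν) * curlF η p (aOne η M p f) m μ ν).re) =
          2 * (∑ μ, ∑ ν, conj (remF η p f m μ ν) * curlF η p (aOne η M p f) m μ ν).re from by
        rw [Complex.re_sum, Finset.mul_sum]
        refine Finset.sum_congr rfl fun μ _ => ?_
        rw [Complex.re_sum, Finset.mul_sum], h0', Complex.zero_re, mul_zero]
    simp only [norm_add_sq_complex, Finset.sum_add_distrib, hre, add_zero]
  unfold sigmaSym
  rw [tensorInner_add_kernel, ← pNormSq_remF f, ← pNormSq_curl_aOne hG f, ← Complex.ofReal_add]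
  congr 1
  unfold energy pNormSq
  rw [← mul_add, ← Finset.sum_add_distrib]
  congr 1
  refine Finset.sum_congr rfl fun m hm => ?_
  rw [← hcross m hm]
  exact Finset.sum_congr rfl fun μ _ => Finset.sum_congr rfl fun ν _ => by beta_reduce; rw [hpt m hm μ ν, norm_neg]

/-- Every constrained A has ‖∂A − Q^{e*}_kf‖² ≥ Σ\bar{f}(τ₁ + τ₂)f (Pythagoras with the normal equations). [cite: BalabanImbrieJaffe1985, (7.1.13) p.322] -/
theorem energy_ge (hG : Generic η M p) {f : Fin d → Fin d → ℂ} (hf : IsTwoForm f) {A : (Fin d → ℤ) → Fin d → ℂ}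
    (hA : ∀ ν, qOp η M p A ν = 0) :
    (tensorInner f (sigmaSym η M p) f).re ≤ energy η M p A f := by
  have hB : ∀ ν, qOp η M p (fun m μ => A m μ - minimiser η M p f m μ) ν = 0 := by
    intro ν; rw [qOp_sub, hA, qOp_minimiser hG, sub_zero]
  have hval : energy η M p (minimiser η M p f) f = (tensorInner f (sigmaSym η M p) f).re := by
    rw [← energy_minimiser hG hf, Complex.ofReal_re]
  have hsplit : energy η M p A f =
      pNormSq M (curlF η p (fun m μ => A m μ - minimiser η M p f m μ)) + energy η M p (minimiser η M p f) f +
        2 * (pInner M (curlF η p (fun m μ => A m μ - minimiser η M p f m μ))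
          (fun m μ ν => curlF η p (minimiser η M p f) m μ ν - qeStar η p f m μ ν)).re := by
    unfold energy
    rw [← pNormSq_add]
    congr 1
    funext m μ ν
    rw [curlF_sub]
    ring
  have hcross : pInner M (curlF η p (fun m μ => A m μ - minimiser η M p f m μ))
      (fun m μ ν => curlF η p (minimiser η M p f) m μ ν - qeStar η p f m μ ν) = 0 := by
    have h := normal_eq hG hf hB
    rw [show (fun m μ ν => curlF η p (minimiser η M p f) m μ ν - qeStar η p f m μ ν) =
        fun m μ ν => -(qeStar η p f m μ ν - curlF η p (minimiser η M p f) m μ ν) from by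
      funext m μ ν; ring, pInner_neg_right, h, neg_zero]
  rw [hsplit, hcross, Complex.zero_re, mul_zero, add_zero, hval]
  linarith [pNormSq_nonneg (M := M) (curlF η p fun m μ => A m μ - minimiser η M p f m μ)]

/-- **(7.1.13) DERIVED**: for antisymmetric f at a generic fibre p′, min{‖∂A − Q^{e*}_kf‖² : Q_kA = 0} is attained (at A*) and
equals Σ_{μνλκ}\bar{f}_{μν}(τ₁ + τ₂)_{μνλκ}(p′)f_{λκ} with τ₁ (7.1.14), τ₂ (7.1.15), a (7.1.16), φ (7.1.10) as printed — *"σ_k = τ₁ + τ₂"*.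
[cite: BalabanImbrieJaffe1985, (7.1.13) p.322] -/
theorem isLeast_energy (hG : Generic η M p) {f : Fin d → Fin d → ℂ} (hf : IsTwoForm f) :
    IsLeast (energySet η M p f) (tensorInner f (sigmaSym η M p) f).re := by
  refine ⟨⟨minimiser η M p f, qOp_minimiser hG f, ?_⟩, ?_⟩
  · rw [← energy_minimiser hG hf, Complex.ofReal_re]
  · rintro E ⟨A, hA, rfl⟩
    exact energy_ge hG hf hA

/-- **(7.1.13)** for the fibre form: ⟨f, σ_k(p′)f⟩ (`sigmaMin`) = Re⟨f, (τ₁ + τ₂)(p′)f⟩, the latter real. [cite: BalabanImbrieJaffe1985, (7.1.13) p.322] -/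
theorem sigmaMin_eq (hG : Generic η M p) {f : Fin d → Fin d → ℂ} (hf : IsTwoForm f) :
    sigmaMin η M p f = (tensorInner f (sigmaSym η M p) f).re ∧ (tensorInner f (sigmaSym η M p) f).im = 0 := by
  refine ⟨(isLeast_energy hG hf).csInf_eq, ?_⟩
  rw [← energy_minimiser hG hf, Complex.ofReal_im]

end Proofs

/-! ## §4 At the scales of the model: genericity, and Theorem 7.1.1 for the energies -/

/-- Genericity at the scales of the model (η = 1/n, cut-off M with 2M + 1 ≤ n, gen-3 `Scale`) for every p′ with all p′_μ ≠ 0,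
|p′_μ| ≤ π (this seat's `dSym_shift_eq_zero_iff`, `lapSym_shift_pos_of_ne_zero`, `mem_regSet`, `phiC_eq_phiSym`). [cite: BalabanImbrieJaffe1985, (7.1.8) p.322] -/
theorem generic_scale (hd : 0 < d) (s : Scale) {p : Fin d → ℝ} (hp : ∀ i, p i ≠ 0 ∧ |p i| ≤ π) :
    Generic s.eta s.M p := by
  have hn : 0 < s.n := by have := s.le; omega
  have hp' : ∀ i, |p i| ≤ π := fun i => (hp i).2
  have hp0 : p ≠ 0 := fun h => (hp ⟨0, hd⟩).1 (by rw [h]; rfl)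
  have hreg := mem_regSet hn s.M hp' hp0
  rw [regSet, Set.mem_setOf_eq, phiC_eq_phiSym hn s.M hp] at hreg
  exact
    { dSym_ne := fun m hm μ h => (hp μ).1 ((dSym_shift_eq_zero_iff s.le (hp' μ) hm).mp h).1
      lap_ne := fun m _ => (lapSym_shift_pos_of_ne_zero hn hp' hp0 m).ne'
      dOne_ne := fun μ h => (hp μ).1 ((dOne_eq_zero_iff_of_abs_le (hp' μ)).mp h)
      phi_pos := hreg.2.1
      enn_ne := hreg.2.2.ne' }

/-- **Theorem 7.1.1 for the energies**: c(d)‖f‖² ≤ ‖∂A − Q^{e*}_kf‖² for every A with Q_kA = 0, every antisymmetric f, every scale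
and every p′ with all 0 < |p′_μ| ≤ π — (7.1.22) (gen-4 `thm711_closedCube'`, c(d) = `c711 d`) transported through (7.1.13).
[cite: BalabanImbrieJaffe1985, (7.1.22) p.324] -/
theorem thm711_energy (hd : 0 < d) (s : Scale) {p : Fin d → ℝ} (hp : ∀ i, p i ≠ 0 ∧ |p i| ≤ π)
    {f : Fin d → Fin d → ℂ} (hf : IsTwoForm f) {A : (Fin d → ℤ) → Fin d → ℂ} (hA : ∀ ν, qOp s.eta s.M p A ν = 0) :
    c711 d * normSq f ≤ energy s.eta s.M p A f := by
  have hn : 0 < s.n := by have := s.le; omega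
  calc c711 d * normSq f ≤ (tensorInner f (sigmaC s.n s.M p) f).re :=
        thm711_closedCube' hd s p (fun i => (hp i).2) hf
    _ = (tensorInner f (sigmaSym s.eta s.M p) f).re := by rw [sigmaC_form_eq hn s.M hp hf]; rfl
    _ ≤ energy s.eta s.M p A f := energy_ge (generic_scale hd s hp) hf hA

end

end Literature.MathematicalPhysics.QuantumFieldTheory.BalabanImbrieJaffe1984to88.BIJ85Eq7113DerivationPart3
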